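import Mathlib
import HarnessLib
import Summits.KontsevichZagierPeriods.Zeta5Search.CatalanTwoAdicRayClosed
import Summits.KontsevichZagierPeriods.Zeta5Search.Denom.CatalanRayPGrowth
import Summits.KontsevichZagierPeriods.Zeta5Search.CatalanTwoAdicPFProof

/-!
# The 2-adic ray chain, closed: `ξ ∉ ℚ` (with an explicit measure) from the Catalan box — UNCONDITIONAL in the kernel

HONEST FRAMING: systematic search; no irrationality claim unless certified.  The constant is the 2-adic number
`ξ = CatalanTwoAdicSeries.xi := (1/8) Σ_{μ≥0} t_{μ+1}/(μ+1) ∈ ℚ₂` (numerically Calegari's `ζ₂(2)`, KNOWN to be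
irrational — Calegari 2005; the identification `ξ = ζ₂(2)` is NOT in the kernel); nothing here concerns Catalan's
real constant `G`.  What is certified is exactly: `∀ r : ℚ, xi ≠ r` and the measure below, for the series `xi`.

fam-catalan × fam-denom (pub-zeta5), `families/catalan/TWOADIC.md` §12 / `families/denom/PCLOSED-API.md` §T-G.
Every named input of the intrinsic 2-adic ray chain (`CatalanTwoAdicRay.ray_measure_intrinsic` at
`P_n := Denom.CatalanRayPClosed.rayPClosed j n`) is now a theorem:
* (a) the 2-adic identity `J₂(n, jn, n, (j+1)n, n) = P_n + ξ·Q_n`: `CatalanTwoAdicPF.J2_eq_of_PF` from the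
  partial-fraction identity `PF n (jn)`, which is **`CatalanTwoAdicPFProof.PF_holds`** (Hermite interpolation:
  a polynomial of degree `≤ J + 2n` divisible by the node polynomial of degree `J + 2n + 1` vanishes), and the
  `ξ`-coefficient `= catalanQ` (`CatalanTwoAdicQxi`);
* (b) integrality `d*_{(j+1)n} d*_{jn} 4^{(2j+1)n} P_n ∈ ℤ` (`j ≥ 4`): fam-denom `rayPClosed_isInt`;
* (c) growth: `|Q_n| ≤ 8(jn+1)e^{b_j n}` (`CatalanRayQBound`), `|P_n| ≤ e^{(b_{j+1}+ε)n}` eventually (fam-denom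
  `abs_rayPClosed_eventually_le_exp`), `Λ_n ≤ e^{((2j+1)(1+2log2)+ε)n}` (`CatalanTwoAdicRayBound`);
* the exact size `‖J₂‖₂ = 2^{−(4(2j+1)n+2)+s₂(jn)+s₂((j+1)n)}` (`CatalanTwoAdicForm.norm_J2`) and the 2-adic
  criterion (`PadicMeasureCriterion`).
Hence, on every ray `j ≥ 4` (the window `h(j, b_{j+1}) < 4(2j+1) log 2` is `growthRate_succ_lt`, `j ≥ 3`; `j = 3` is
excluded by fam-denom's `rayMult_three_two_not_int`):

  **`xi_not_ratCast : ∀ r : ℚ, ξ ≠ r`** (ray `j = 4`),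
  **`xi_ray_measure (hj : 4 ≤ j)` : `‖ξ − u/v‖₂ ≥ C · max(|u|,v)^{−κ}`, some `C > 0`,**
  **`κ = τ'/(τ − h(j,b_{j+1}))` EXACTLY,** for any `h(j, b_{j+1}) < τ < 4(2j+1) log 2 < τ'`,
  `h(j,b) = b + (2j+1)(1 + 2 log 2)`, `b_j = (j+1)log(j+1) − j log j`; so `μ₂(ξ) ≤ κ_j* :=
  4(2j+1) log 2/(4(2j+1) log 2 − h(j,b_{j+1}))` on every ray (numerically: `j = 4`: margin `0.773`, `κ_4* = 32.27`;
  `j = 16`: `10.30`; `j = 64`: `8.01`; `j → ∞`: `↓ 8 log 2/(4 log 2 − 2) = 7.1774` = exactly the measure Bel's lemma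
  extracts from Calegari 2005 Thm 4.2 / Beukers 2008 Thm 13 for `ζ₂(2)` — a TIE in the limit, finite rays weaker; the
  sharp `κ =` form replaces v1's `∃ κ < … + 1` packaging: fam-denom g5 review, lead ruling 2026-08-21).

The conditional forms `xi_not_ratCast_of_PF` / `ray_measure_of_PF` (hypothesis `RayPF j`) are kept for the record;
`rayPF_holds` discharges them.
-/

noncomputable section

namespace Summit.KontsevichZagierPeriods.Zeta5Search.CatalanTwoAdicSeries

open Real
open Summit.KontsevichZagierPeriods.Zeta5Search.Denom.CatalanRayPClosed (abs_rayPClosed_eventually_le_exp)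

/-- (T-G) at the kernel rate is fam-denom's theorem: `RayPGrowthAt j (b_{j+1})` for every `j ≥ 1`. -/
theorem rayPGrowthAt_succ (j : ℕ) (hj : 1 ≤ j) : RayPGrowthAt j (bRate (j + 1)) :=
  fun _ hε => abs_rayPClosed_eventually_le_exp j hj hε

/-- **`ξ ∉ ℚ` from the partial-fraction identity on one ray `j ≥ 4`**: `RayPF j → ∀ r : ℚ, ξ ≠ r`. -/
theorem xi_not_ratCast_of_PF {j : ℕ} (hj : 4 ≤ j) (hPF : RayPF j) : ∀ r : ℚ, xi ≠ ((r : ℚ) : ℚ_[2]) :=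
  xi_not_ratCast_succRate hj hPF (rayPGrowthAt_succ j (by omega))

/-- **The irrationality measure from the partial-fraction identity on one ray `j ≥ 4`**: for
`h(j, b_{j+1}) < τ < 4(2j+1) log 2 < τ'` there is `C > 0` with
`‖ξ − r‖₂ ≥ C · max(|num r|, den r)^{−κ}`, `κ = τ'/(τ − h(j, b_{j+1}))` EXACTLY, for every rational `r`. -/
theorem ray_measure_of_PF {j : ℕ} (hj : 4 ≤ j) (hPF : RayPF j)
    {τ τ' : ℝ} (hτ1 : growthRate j (bRate (j + 1)) < τ) (hτ2 : τ < 4 * (2 * j + 1) * log 2)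
    (hτ' : 4 * (2 * j + 1) * log 2 < τ') :
    ∃ C : ℝ, 0 < C ∧ ∀ r : ℚ,
      C * (max (r.num.natAbs : ℝ) r.den) ^ (-(τ' / (τ - growthRate j (bRate (j + 1)))))
        ≤ ‖xi - ((r : ℚ) : ℚ_[2])‖ :=
  ray_measure_succRate hj hPF (rayPGrowthAt_succ j (by omega)) hτ1 hτ2 hτ'

/-- The admissible window is non-empty on every ray `j ≥ 3`: `h(j, b_{j+1}) < 4(2j+1) log 2`
(re-export of `growthRate_succ_lt` for the record: `j = 4`: `h = 2.703 + 9(1 + 2 log 2) = 24.18 < 24.95`). -/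
theorem measure_window_nonempty (j : ℕ) (hj : 3 ≤ j) :
    growthRate j (bRate (j + 1)) < 4 * (2 * j + 1) * log 2 :=
  growthRate_succ_lt j hj

/-! ### Unconditional forms -/

/-- **(L2) discharged**: `RayPF j` for every `j ≥ 1` (`CatalanTwoAdicPFProof.PF_ray`). -/
theorem rayPF_holds (j : ℕ) (hj : 1 ≤ j) : RayPF j := fun n _ => PF_ray j n hj

/-- **`ξ ∉ ℚ`, unconditionally**: the 2-adic number `ξ = (1/8) Σ t_{μ+1}/(μ+1)` is not (the image of) a rational —
the 2-adic Catalan-box chain on the ray `j = 4`. -/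
theorem xi_not_ratCast (r : ℚ) : xi ≠ ((r : ℚ) : ℚ_[2]) :=
  xi_not_ratCast_of_PF (j := 4) le_rfl (rayPF_holds 4 (by norm_num)) r

/-- **The 2-adic irrationality measure of `ξ`, unconditionally**, on every ray `j ≥ 4`: for
`h(j, b_{j+1}) < τ < 4(2j+1) log 2 < τ'` there is `C > 0` with
`‖ξ − r‖₂ ≥ C · max(|num r|, den r)^{−κ}`, `κ = τ'/(τ − h(j, b_{j+1}))` EXACTLY, for every rational `r`
(`ξ` is not a 2-adic Liouville number; `μ₂(ξ) ≤ 4(2j+1) log 2/(4(2j+1) log 2 − h(j, b_{j+1}))` on every ray,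
`↓ 8 log 2/(4 log 2 − 2) = 7.1774` as `j → ∞`). -/
theorem xi_ray_measure {j : ℕ} (hj : 4 ≤ j)
    {τ τ' : ℝ} (hτ1 : growthRate j (bRate (j + 1)) < τ) (hτ2 : τ < 4 * (2 * j + 1) * log 2)
    (hτ' : 4 * (2 * j + 1) * log 2 < τ') :
    ∃ C : ℝ, 0 < C ∧ ∀ r : ℚ,
      C * (max (r.num.natAbs : ℝ) r.den) ^ (-(τ' / (τ - growthRate j (bRate (j + 1)))))
        ≤ ‖xi - ((r : ℚ) : ℚ_[2])‖ :=
  ray_measure_of_PF hj (rayPF_holds j (by omega)) hτ1 hτ2 hτ'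

/-- the measure on the first admissible ray, with the window made explicit: any
`τ ∈ (h(4, b_5), 36 log 2)`, `τ' > 36 log 2`; exponent `κ = τ'/(τ − h(4, b_5))` EXACTLY (`h(4, b_5) = 24.180…`,
`36 log 2 = 24.953…`, so `μ₂(ξ) ≤ 32.27`). -/
theorem xi_measure_ray_four {τ τ' : ℝ} (hτ1 : growthRate 4 (bRate 5) < τ) (hτ2 : τ < 36 * log 2)
    (hτ' : 36 * log 2 < τ') :
    ∃ C : ℝ, 0 < C ∧ ∀ r : ℚ,
      C * (max (r.num.natAbs : ℝ) r.den) ^ (-(τ' / (τ - growthRate 4 (bRate 5)))) ≤ ‖xi - ((r : ℚ) : ℚ_[2])‖ := by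
  have h := xi_ray_measure (j := 4) le_rfl (τ := τ) (τ' := τ') hτ1 (by push_cast; linarith) (by push_cast; linarith)
  simpa using h

end Summit.KontsevichZagierPeriods.Zeta5Search.CatalanTwoAdicSeries

end
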